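/-
COR-CM (cell pub-hodgecm2 = stage 2 of the Hodge ladder), seat b26 gen 17 (prover-pub-hodgecm2-b26-g17-0, 2026-08-21);
count-neutral for the binder table (no row).  Sequel of `Assembly/EllipticCurvePeriod`: the endomorphism algebra of
EVERY complex elliptic curve, and the CM dichotomy, with no period hypothesis.  Theorems only: no definition, no
notation, no named fact, no instance.
-/
import Summits.HodgeConjecture.CorCM.Assembly.EllipticCurvePeriod
import Summits.HodgeConjecture.CorCM.Assembly.CMEllipticCurveOfPeriodEndAlgebra
import Summits.HodgeConjecture.CorCM.Assembly.EllipticCurvesOfPeriodsIsogenous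
import Literature.AlgebraicGeometry.HodgeTheory.EllipticCurvesProductsHodgeConjecture
import Literature.AlgebraicGeometry.HodgeTheory.RibetTotallyRealHodgeClasses
import Literature.AlgebraicGeometry.ComplexMultiplication.ShimuraIsogenyHolds
import Literature.AlgebraicGeometry.ComplexMultiplication.CMTypeOfSimpleSubvariety
import Literature.AlgebraicGeometry.Milne1999.CMTypeSimpleIsogenyFactors
import HarnessLib

/-!
# The endomorphism algebra of a complex elliptic curve: `ℚ` or an imaginary quadratic field

Moonen–Zarhin 1999 (2.1), `g = 1`: for a complex elliptic curve `X`, «either `End⁰ X = ℚ` (Type I(1)) or `X` has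
complex multiplication by an imaginary quadratic field `End⁰ X` (Type IV(1,1))»; Silverman AEC VI Thm. 5.5 /
III Cor. 9.4: `End(E) ⊗ ℚ` is `ℚ` or an imaginary quadratic field.  Gen 16 proved these statements for the complex
abelian varieties `A` with a PERIOD STRUCTURE `H¹_B(A) ≅ V¹_τ` (`Assembly/CMEllipticCurveOfPeriod[EndAlgebra]`);
by `Assembly/EllipticCurvePeriod` (`exists_model_periodHom`: every elliptic curve has one) they now hold for
**every complex abelian variety `A` of dimension `1`**, unconditionally and hypothesis-free:

* `finrank_endAlgebra_le_two_of_dim_eq_one`, `finrank_endAlgebra_eq_one_or_eq_two_of_dim_eq_one` —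
  **`dim_ℚ End⁰(A) ∈ {1, 2}`**;
* `endAlgebra_comm_of_dim_eq_one`, `isField_endAlgebra_of_dim_eq_one`, `isReduced_endAlgebra_of_dim_eq_one` —
  **`End⁰(A)` is a (commutative) field** (inverses from simplicity, Mumford §19 Cor. 2:
  `endAlgebra_exists_inv_of_isSimple`, `isSimple_of_dim_le_one`);
* THE CM DICHOTOMY, four equivalent forms of «`A` has complex multiplication»:
  `isOfCMType_iff_exists_cm_of_dim_eq_one` (**`Milne1999.IsOfCMType A ↔ ∃ ψ : A ⟶ A, ψ ≫ ψ = -(d • 𝟙 A), d ≥ 1`**),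
  `finrank_endAlgebra_eq_two_iff_isOfCMType` (**`↔ dim_ℚ End⁰(A) = 2`**),
  `isOfCMType_iff_not_hodgeEndTrivial_of_dim_eq_one` (file `EllipticCurvePeriod`: **`↔ ¬ HodgeEndTrivial A`**),
  `isOfCMTypeSimple_iff_isOfCMType_of_dim_eq_one` (Milne's clause for simple varieties); and of its negation:
  `finrank_endAlgebra_eq_one_iff_hodgeEndTrivial`, `hodgeEndTrivial_iff_forall_exists_eq_algebraMap`
  (**`HodgeEndTrivial A ↔ End⁰(A) = ℚ·1`**);
* the number field `End⁰(A)` (`EndField A hF`) is **a CM field if `A` is of CM type and totally real (`= ℚ`)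
  otherwise** (`isCMField_endField_of_isOfCMType_of_dim_eq_one`, via the tree's
  `isCMField_endField_of_isSimple`; `isTotallyReal_endField_of_not_isOfCMType_of_dim_eq_one`);
* `exists_periods_isIsogenous_iff` — **any two complex elliptic curves have periods `τ, τ' ∈ 𝔥`, and they are
  isogenous iff `τ' ∈ GL₂(ℚ) · τ`** (gen 16's `isIsogenous_iff` with both period hypotheses discharged).

HONEST SCOPE: the classical structure of `End⁰` of complex elliptic curves, obtained through Hodge theory and
Riemann's theorem (tree theorems `deligneMilne1982_Thm_6_20_full_holds` / `_essImage_holds`); nothing here bears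
on HC_CM or on the summit.

References: [MoonenZarhin1999LowDim] B. Moonen, Yu. Zarhin, Math. Ann. 315 (1999), §2 (2.1) ·
[SilvermanAEC2009] J. Silverman, *The Arithmetic of Elliptic Curves*, III Cor. 9.4, VI Thm. 5.5 · [MumfordAV1970]
D. Mumford, *Abelian Varieties*, §19 Cor. 2 of Thm. 1 · [Milne1999] J. S. Milne, Compositio Math. 117 (1999), §2
p. 54 · [Shimura1998] G. Shimura, *Abelian Varieties with Complex Multiplication and Modular Functions*, §5.1
Prop. 5 · [DeligneMilne1982Tannakian] LNM 900, art. II §6 Thm. 6.20 (Riemann), p. 212.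
-/

noncomputable section

open scoped TensorProduct
open CategoryTheory Module TensorProduct
open Literature.AlgebraicGeometry.Motives Literature.AlgebraicGeometry.HodgeTheory
open Literature.AlgebraicGeometry.ComplexMultiplication Literature.AlgebraicGeometry.Milne1999
open Literature.AlgebraicGeometry.Motives.HodgeStructure

namespace Summit.HodgeConjecture.CorCM.PeriodCurve

/-! ## §1 Normalising a rational quadratic equation -/

/-- `a τ² + b τ + c = 0` with `a ≠ 0` gives the monic equation `τ² + (b/a) τ + (c/a) = 0`. [folklore] -/
theorem exists_monic_of_quadratic {τ : ℂ} (h : ∃ a b c : ℚ, a ≠ 0 ∧ (a : ℂ) * τ ^ 2 + b * τ + c = 0) :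
    ∃ p q : ℚ, τ ^ 2 + p * τ + q = 0 := by
  obtain ⟨a, b, c, ha, h⟩ := h
  refine ⟨b / a, c / a, ?_⟩
  have ha' : (a : ℂ) ≠ 0 := by exact_mod_cast ha
  push_cast
  field_simp
  linear_combination h

/-! ## §2 `End⁰` of every complex elliptic curve -/

section EllipticCurve

variable {A : AbelianVariety ℂ}

/-- **THE DICHOTOMY FOR EVERY ELLIPTIC CURVE, with its period.**  For `A` of dimension `1` there are a Hodge
symmetric model `B`, `τ` with `Im τ > 0` and `H¹_B(A) ≅ V¹_τ`, and EITHER `τ` satisfies a monic rational quadratic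
equation, `A` is of CM type, `¬ HodgeEndTrivial A` and `dim_ℚ End⁰(A) = 2`, OR every endomorphism of `V¹_τ` is a
rational scalar, `A` is not of CM type, `HodgeEndTrivial A`, `dim_ℚ End⁰(A) = 1` and `End⁰(A) = ℚ·1`
(Moonen–Zarhin (2.1), `g = 1`: Type IV(1,1) versus Type I(1)). [cite: MoonenZarhin1999LowDim, §2 (2.1) (g = 1)]
[cite: SilvermanAEC2009, VI Thm. 5.5] [cite: DeligneMilne1982Tannakian, art. II §6 Thm. 6.20 (Riemann), LNM 900 p. 212] -/
theorem dichotomy_of_dim_eq_one (hA : A.dim = 1) :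
    (Literature.AlgebraicGeometry.Milne1999.IsOfCMType A ∧ ¬ EllipticCurve.HodgeEndTrivial A ∧
        Module.finrank ℚ A.endAlgebra = 2 ∧ (∀ x y : A.endAlgebra, x * y = y * x) ∧ IsReduced A.endAlgebra) ∨
      (¬ Literature.AlgebraicGeometry.Milne1999.IsOfCMType A ∧ EllipticCurve.HodgeEndTrivial A ∧
        Module.finrank ℚ A.endAlgebra = 1 ∧ ∀ x : A.endAlgebra, ∃ c : ℚ, x = algebraMap ℚ A.endAlgebra c) := by
  obtain ⟨B, hB, τ, hτ, f, hf⟩ := exists_model_periodHom hA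
  obtain ⟨h0, h1⟩ := coords_periodVector τ
  have hP := PeriodHodgeStructure.isCompl_span h0 h1 hτ.ne'
  by_cases hq : ∃ a b c : ℚ, a ≠ 0 ∧ (a : ℂ) * τ ^ 2 + b * τ + c = 0
  · obtain ⟨p, q, hτ2⟩ := exists_monic_of_quadratic hq
    exact Or.inl ⟨isOfCMType h0 h1 hP f hf hτ2 hτ.ne', not_hodgeEndTrivial h0 h1 hP f hf hτ2 hτ.ne',
      finrank_endAlgebra_eq_two h0 h1 hP f hf hτ2 hτ.ne', endAlgebra_comm h0 h1 hP f hf hτ2 hτ.ne',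
      isReduced_endAlgebra h0 h1 hP f hf hτ2 hτ.ne'⟩
  · have h₂ := (PeriodHodgeStructure.forall_hom_eq_smul_iff h0 h1 hP hτ.ne').2
      ((PeriodHodgeStructure.noQuadratic_iff hτ.ne').2 hq)
    have hA0 : 0 < A.dim := by rw [hA]; exact one_pos
    exact Or.inr ⟨NonCMCurve.not_isOfCMType f hf h₂ hA0, NonCMCurve.hodgeEndTrivial_of_hom f hf h₂,
      NonCMCurve.finrank_endAlgebra_eq_one f hf h₂ hA0, NonCMCurve.exists_eq_algebraMap f hf h₂⟩

/-- **`dim_ℚ End⁰(A) ∈ {1, 2}` for every complex elliptic curve.** [cite: MoonenZarhin1999LowDim, §2 (2.1) (g = 1)]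
[cite: SilvermanAEC2009, III Cor. 9.4 and VI Thm. 5.5] -/
theorem finrank_endAlgebra_eq_one_or_eq_two_of_dim_eq_one (hA : A.dim = 1) :
    Module.finrank ℚ A.endAlgebra = 1 ∨ Module.finrank ℚ A.endAlgebra = 2 := by
  rcases dichotomy_of_dim_eq_one hA with ⟨-, -, h, -⟩ | ⟨-, -, h, -⟩
  · exact Or.inr h
  · exact Or.inl h

/-- **`dim_ℚ End⁰(A) ≤ 2` for every complex elliptic curve.** [cite: MoonenZarhin1999LowDim, §2 (2.1) (g = 1)]
[cite: SilvermanAEC2009, III Cor. 9.4] -/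
theorem finrank_endAlgebra_le_two_of_dim_eq_one (hA : A.dim = 1) : Module.finrank ℚ A.endAlgebra ≤ 2 := by
  rcases finrank_endAlgebra_eq_one_or_eq_two_of_dim_eq_one hA with h | h <;> omega

/-- **`1 ≤ dim_ℚ End⁰(A)`** (the scalars) for every complex elliptic curve. [folklore] -/
theorem one_le_finrank_endAlgebra_of_dim_eq_one (hA : A.dim = 1) : 1 ≤ Module.finrank ℚ A.endAlgebra := by
  rcases finrank_endAlgebra_eq_one_or_eq_two_of_dim_eq_one hA with h | h <;> omega

/-- **`End⁰(A)` is commutative for every complex elliptic curve** (it is `ℚ` or an imaginary quadratic field).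
[cite: MoonenZarhin1999LowDim, §2 (2.1) (g = 1)] [cite: SilvermanAEC2009, III Cor. 9.4] -/
theorem endAlgebra_comm_of_dim_eq_one (hA : A.dim = 1) (x y : A.endAlgebra) : x * y = y * x := by
  rcases dichotomy_of_dim_eq_one hA with ⟨-, -, -, hcomm, -⟩ | ⟨-, -, -, hscal⟩
  · exact hcomm x y
  · obtain ⟨c, rfl⟩ := hscal x
    exact Algebra.commutes c y

/-- **`End⁰(A)` is a field for every complex elliptic curve**: commutative (`endAlgebra_comm_of_dim_eq_one`),
non-trivial, and every non-zero element is invertible because `A` is simple (`isSimple_of_dim_le_one`; Mumford §19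
Cor. 2, `endAlgebra_exists_inv_of_isSimple`). [cite: MumfordAV1970, §19 Cor. 2 of Thm. 1 (p. 174)]
[cite: SilvermanAEC2009, III Cor. 9.4] -/
theorem isField_endAlgebra_of_dim_eq_one (hA : A.dim = 1) : IsField A.endAlgebra := by
  haveI : Nontrivial A.endAlgebra :=
    Module.nontrivial_of_finrank_pos (R := ℚ) (one_le_finrank_endAlgebra_of_dim_eq_one hA)
  refine ⟨exists_pair_ne A.endAlgebra, endAlgebra_comm_of_dim_eq_one hA, fun {a} ha => ?_⟩
  obtain ⟨b, hab, -⟩ := endAlgebra_exists_inv_of_isSimple (AbelianVariety.isSimple_of_dim_le_one hA.le) a ha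
  exact ⟨b, hab⟩

/-- **`End⁰(A)` is reduced for every complex elliptic curve** (a field). [cite: SilvermanAEC2009, III Cor. 9.4] -/
theorem isReduced_endAlgebra_of_dim_eq_one (hA : A.dim = 1) : IsReduced A.endAlgebra := by
  letI : Field A.endAlgebra := (isField_endAlgebra_of_dim_eq_one hA).toField
  infer_instance

/-- **CM type iff a complex multiplication, for every complex elliptic curve**: `Milne1999.IsOfCMType A` iff `A`
carries `ψ : A ⟶ A` with `ψ ≫ ψ = -(d • 𝟙 A)` for some `d ≥ 1` (`isOfCMType_iff_not_hodgeEndTrivial_of_dim_eq_one`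
and the tree's `EllipticCurve.moonenZarhin_21_hodgeEndTrivial_iff`). [cite: MoonenZarhin1999LowDim, §2 (2.1) (g = 1)]
[cite: Milne1999, §2 p. 54] [cite: SilvermanAEC2009, VI Thm. 5.5] -/
theorem isOfCMType_iff_exists_cm_of_dim_eq_one (hA : A.dim = 1) :
    Literature.AlgebraicGeometry.Milne1999.IsOfCMType A ↔ ∃ (ψ : A ⟶ A) (d : ℕ), 0 < d ∧ ψ ≫ ψ = -(d • 𝟙 A) := by
  rw [isOfCMType_iff_not_hodgeEndTrivial_of_dim_eq_one hA, EllipticCurve.moonenZarhin_21_hodgeEndTrivial_iff hA,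
    not_not]

/-- **`dim_ℚ End⁰(A) = 2` iff `A` is of CM type**, for every complex elliptic curve.
[cite: MoonenZarhin1999LowDim, §2 (2.1) (g = 1)] [cite: Milne1999, §2 p. 54] -/
theorem finrank_endAlgebra_eq_two_iff_isOfCMType (hA : A.dim = 1) :
    Module.finrank ℚ A.endAlgebra = 2 ↔ Literature.AlgebraicGeometry.Milne1999.IsOfCMType A := by
  rcases dichotomy_of_dim_eq_one hA with ⟨hcm, -, h2, -⟩ | ⟨hcm, -, h1, -⟩
  · exact ⟨fun _ => hcm, fun _ => h2⟩
  · rw [h1]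
    exact ⟨fun h => by omega, fun h => absurd h hcm⟩

/-- **`dim_ℚ End⁰(A) = 1` iff `HodgeEndTrivial A`**, for every complex elliptic curve (Type I(1)).
[cite: MoonenZarhin1999LowDim, §2 (2.1) (g = 1)] -/
theorem finrank_endAlgebra_eq_one_iff_hodgeEndTrivial (hA : A.dim = 1) :
    Module.finrank ℚ A.endAlgebra = 1 ↔ EllipticCurve.HodgeEndTrivial A := by
  rcases dichotomy_of_dim_eq_one hA with ⟨-, hT, h2, -⟩ | ⟨-, hT, h1, -⟩
  · rw [h2]
    exact ⟨fun h => by omega, fun h => absurd h hT⟩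
  · exact ⟨fun _ => hT, fun _ => h1⟩

/-- **`dim_ℚ End⁰(A) = 1` iff `A` is not of CM type**, for every complex elliptic curve.
[cite: MoonenZarhin1999LowDim, §2 (2.1) (g = 1)] [cite: Milne1999, §2 p. 54] -/
theorem finrank_endAlgebra_eq_one_iff_not_isOfCMType (hA : A.dim = 1) :
    Module.finrank ℚ A.endAlgebra = 1 ↔ ¬ Literature.AlgebraicGeometry.Milne1999.IsOfCMType A := by
  rw [← finrank_endAlgebra_eq_two_iff_isOfCMType hA]
  rcases finrank_endAlgebra_eq_one_or_eq_two_of_dim_eq_one hA with h | h <;> omega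

/-- **`HodgeEndTrivial A` iff `End⁰(A) = ℚ·1`**, for every complex elliptic curve: every element of `End⁰(A)` is
a rational scalar iff the Hodge structure `H¹(A)` has only scalar endomorphisms (Type I(1)).
[cite: MoonenZarhin1999LowDim, §2 (2.1) (g = 1)] [cite: DeligneMilne1982Tannakian, art. II §6 Thm. 6.20 (Riemann), LNM 900 p. 212] -/
theorem hodgeEndTrivial_iff_forall_exists_eq_algebraMap (hA : A.dim = 1) :
    EllipticCurve.HodgeEndTrivial A ↔ ∀ x : A.endAlgebra, ∃ c : ℚ, x = algebraMap ℚ A.endAlgebra c := by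
  rcases dichotomy_of_dim_eq_one hA with ⟨-, hT, h2, -⟩ | ⟨-, hT, -, hscal⟩
  · refine ⟨fun h => absurd h hT, fun h => ?_⟩
    -- all scalars: `dim ≤ 1`, contradicting `dim = 2`
    exfalso
    haveI : Module.Finite ℚ A.endAlgebra := AbelianVariety.finiteDimensional_endAlgebra_holds A
    have hle : Module.finrank ℚ A.endAlgebra ≤ 1 := by
      have hrange : (⊤ : Submodule ℚ A.endAlgebra) ≤ LinearMap.range (Algebra.linearMap ℚ A.endAlgebra) := by
        rintro x -
        obtain ⟨c, rfl⟩ := h x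
        exact ⟨c, rfl⟩
      calc Module.finrank ℚ A.endAlgebra = Module.finrank ℚ (⊤ : Submodule ℚ A.endAlgebra) :=
            (finrank_top ℚ A.endAlgebra).symm
        _ ≤ Module.finrank ℚ (LinearMap.range (Algebra.linearMap ℚ A.endAlgebra)) := Submodule.finrank_mono hrange
        _ ≤ Module.finrank ℚ ℚ := LinearMap.finrank_range_le _
        _ = 1 := Module.finrank_self ℚ
    omega
  · exact ⟨fun _ => hscal, fun _ => hT⟩

/-- **Milne's clause for simple varieties agrees with the étale form on elliptic curves**: `IsOfCMTypeSimple A`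
(`End⁰(A)` a field of degree `2 dim A`) iff `IsOfCMType A` (an elliptic curve is simple, `isSimple_of_dim_le_one`).
[cite: Milne1999, §2 p. 54] -/
theorem isOfCMTypeSimple_iff_isOfCMType_of_dim_eq_one (hA : A.dim = 1) :
    IsOfCMTypeSimple A ↔ Literature.AlgebraicGeometry.Milne1999.IsOfCMType A :=
  ⟨IsOfCMTypeSimple.isOfCMType, fun h =>
    h.isOfCMTypeSimple (AbelianVariety.isSimple_of_dim_le_one hA.le) (by rw [hA]; exact one_pos)⟩

/-- **For a CM elliptic curve, the number field `End⁰(A)` is a CM field** (an imaginary quadratic field): the tree's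
`isCMField_endField_of_isSimple` (Shimura §5.1 Prop. 5 / Deligne 1982 I Prop. 5.1) at `isSimple_of_dim_le_one`.
[cite: Shimura1998, §5.1 Proposition 5] [cite: MoonenZarhin1999LowDim, §2 (2.1) (g = 1)] -/
theorem isCMField_endField_of_isOfCMType_of_dim_eq_one (hA : A.dim = 1)
    (hCM : Literature.AlgebraicGeometry.Milne1999.IsOfCMType A) (hF : IsField A.endAlgebra) :
    NumberField.IsCMField (EndField A hF) :=
  isCMField_endField_of_isSimple (AbelianVariety.isSimple_of_dim_le_one hA.le) (by rw [hA]; exact one_pos) hCM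

/-- **For a non-CM elliptic curve, the number field `End⁰(A)` is totally real** (it is `ℚ`: degree `1`,
`isTotallyReal_endField_of_finrank_eq_one`). [cite: MoonenZarhin1999LowDim, §2 (2.1) (g = 1)] -/
theorem isTotallyReal_endField_of_not_isOfCMType_of_dim_eq_one (hA : A.dim = 1)
    (hCM : ¬ Literature.AlgebraicGeometry.Milne1999.IsOfCMType A) (hF : IsField A.endAlgebra) :
    NumberField.IsTotallyReal (EndField A hF) :=
  isTotallyReal_endField_of_finrank_eq_one hF ((finrank_endAlgebra_eq_one_iff_not_isOfCMType hA).2 hCM)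

/-- **The degree of the number field `End⁰(A)` of an elliptic curve is `1` or `2`.** [cite: SilvermanAEC2009, III Cor. 9.4] -/
theorem finrank_endField_eq_one_or_eq_two_of_dim_eq_one (hA : A.dim = 1) (hF : IsField A.endAlgebra) :
    Module.finrank ℚ (EndField A hF) = 1 ∨ Module.finrank ℚ (EndField A hF) = 2 := by
  rw [EndField.finrank_eq hF]
  exact finrank_endAlgebra_eq_one_or_eq_two_of_dim_eq_one hA

end EllipticCurve

/-! ## §3 Isogeny classes of all elliptic curves by their periods -/

/-- **ANY TWO COMPLEX ELLIPTIC CURVES HAVE PERIODS, AND ARE ISOGENOUS IFF THE PERIODS ARE `GL₂(ℚ)`-RELATED.**  For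
`E`, `E'` of dimension `1` there are `τ, τ'` with `Im τ, Im τ' > 0`, Hodge symmetric models and isomorphisms
`H¹_B(E) ≅ V¹_τ`, `H¹_B(E') ≅ V¹_τ'` in `Hod_ℚ` (`exists_model_periodHom`), and **`E ~ E'` iff
`τ' (a + bτ) = c + dτ` for some rationals `a, b, c, d` with `a + bτ ≠ 0`**, i.e. `τ' ∈ GL₂(ℚ) · τ` (gen 16's
`isIsogenous_iff`, both period hypotheses discharged). [cite: MoonenZarhin1999LowDim, §3 Lemma (3.3) and Cor. (3.9)]
[cite: SilvermanAEC2009, VI §4 Thm. 4.1 and §5] [cite: DeligneMilne1982Tannakian, art. II §6 Thm. 6.20 (Riemann), LNM 900 p. 212] -/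
theorem exists_periods_isIsogenous_iff {E E' : AbelianVariety ℂ} (hE : E.dim = 1) (hE' : E'.dim = 1) :
    ∃ τ τ' : ℂ, 0 < τ.im ∧ 0 < τ'.im ∧
      (∃ (B : HodgeModel E.dim E.X) (hB : B.IsHodgeSymmetric) (H : HodgeStructure (Fin 2 → ℚ) 1)
        (f : Hom (bettiOneHodgeStructure E B hB) H), Function.Bijective f.toLinearMap ∧
          H.F 1 = ℂ ∙ ((1 : ℂ) ⊗ₜ[ℚ] (Pi.single 0 1 : Fin 2 → ℚ) + τ ⊗ₜ[ℚ] Pi.single 1 1)) ∧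
      (∃ (B' : HodgeModel E'.dim E'.X) (hB' : B'.IsHodgeSymmetric) (H' : HodgeStructure (Fin 2 → ℚ) 1)
        (f' : Hom (bettiOneHodgeStructure E' B' hB') H'), Function.Bijective f'.toLinearMap ∧
          H'.F 1 = ℂ ∙ ((1 : ℂ) ⊗ₜ[ℚ] (Pi.single 0 1 : Fin 2 → ℚ) + τ' ⊗ₜ[ℚ] Pi.single 1 1)) ∧
      (E.IsIsogenous E' ↔ ∃ a b c d : ℚ, (a : ℂ) + b * τ ≠ 0 ∧ τ' * (a + b * τ) = c + d * τ) := by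
  obtain ⟨B, hB, τ, hτ, f, hf⟩ := exists_model_periodHom hE
  obtain ⟨B', hB', τ', hτ', f', hf'⟩ := exists_model_periodHom hE'
  obtain ⟨h0, h1⟩ := coords_periodVector τ
  obtain ⟨h0', h1'⟩ := coords_periodVector τ'
  have hP := PeriodHodgeStructure.isCompl_span h0 h1 hτ.ne'
  have hP' := PeriodHodgeStructure.isCompl_span h0' h1' hτ'.ne'
  exact ⟨τ, τ', hτ, hτ', ⟨B, hB, _, f, hf, PeriodHodgeStructure.F_one hP⟩,
    ⟨B', hB', _, f', hf', PeriodHodgeStructure.F_one hP'⟩, isIsogenous_iff h0 h1 h0' h1' hP hP' f hf f' hf' hτ.ne'⟩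

/-- **CM elliptic curves: a period in `ℚ(√-d)`.**  An elliptic curve of CM type has a period `τ` with `Im τ > 0`
satisfying a monic rational quadratic equation `τ² + pτ + q = 0` (so `ℚ(τ)` is imaginary quadratic and
`H¹_B(A) ≅ V¹_τ`). [cite: MoonenZarhin1999LowDim, §2 (2.1) (g = 1), Type IV(1,1)] [cite: SilvermanAEC2009, VI Thm. 5.5] -/
theorem exists_quadratic_period_of_isOfCMType {A : AbelianVariety ℂ} (hA : A.dim = 1)
    (hCM : Literature.AlgebraicGeometry.Milne1999.IsOfCMType A) :
    ∃ (τ : ℂ) (p q : ℚ), 0 < τ.im ∧ τ ^ 2 + p * τ + q = 0 ∧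
      ∃ (B : HodgeModel A.dim A.X) (hB : B.IsHodgeSymmetric) (H : HodgeStructure (Fin 2 → ℚ) 1)
        (f : Hom (bettiOneHodgeStructure A B hB) H), Function.Bijective f.toLinearMap ∧
          H.F 1 = ℂ ∙ ((1 : ℂ) ⊗ₜ[ℚ] (Pi.single 0 1 : Fin 2 → ℚ) + τ ⊗ₜ[ℚ] Pi.single 1 1) := by
  obtain ⟨B, hB, τ, hτ, f, hf⟩ := exists_model_periodHom hA
  obtain ⟨h0, h1⟩ := coords_periodVector τ
  have hP := PeriodHodgeStructure.isCompl_span h0 h1 hτ.ne'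
  obtain ⟨p, q, hτ2⟩ := exists_monic_of_quadratic ((isOfCMType_iff h0 h1 hP f hf hτ.ne').1 hCM)
  exact ⟨τ, p, q, hτ, hτ2, B, hB, _, f, hf, PeriodHodgeStructure.F_one hP⟩

end Summit.HodgeConjecture.CorCM.PeriodCurve

end
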